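import Summits.QuantumFields.BalabanUV.T4Continuum.Support.VariationalKKT
import Summits.QuantumFields.BalabanUV.T4Continuum.Support.VariationalCovariantScalarPair
import Summits.QuantumFields.BalabanUV.T4Continuum.Support.VariationalOpNorm

/-!
# T⁴ programme, spine node NE2 (U1a), lane P2 — LEAF D INSTANTIATED FOR THE CHARGED SCALAR: the covariant effective actions
# `Δ′_k(μ) = min {c·Σ|D_R f|² : Q f = μ}` ARE HERMITIAN QUADRATIC FORMS `re μ†X μ` of the unit datum, and the canonical-pair bracket of
# `VariationalCovariantScalarPair.scalar_pair_bracket` therefore reads in row NE2's consumer currency `‖X_{k+1} − X_k‖ ≤ max(e, e′)`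
# (`t4/skeletons/NE2-t4-ne2-p2.md` v0.7 §2.C leaf D / §3; cell `pub-balaban`, row NE2 co-owner #2, lineage t4-ne2-p2 gen 10)

HONEST FRAMING (T4-DAG p. 1).  Rung (B)+1 only — NOT infinite volume, NOT a mass gap, NOT Clay.  NE2 is NOT IN PRINT and NOT proved here.  MODEL
LEVEL (charged scalar, U(1) bond phases `R` and unit-modulus site transports `T` as DATA).  What is kernel here ([folklore] linear algebra on the
tree's carriers): the matrices of the covariant Dirichlet form (`Dmat`, `Smat`) and of the transported average (`Qmat`, with `Qmat·Qmatᴴ = L_b^{−d}·1`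
for unit-modulus transports), their form identities, op-norm bounds and coercivity FROM A P⁺-SHAPED INEQUALITY, and the instantiation of
`VariationalKKT.blockSpin_eq_quadForm`: **`blockSpin_dirichlet_eq_form`** — for every level torus, every such data and every constraint matrix with
orthogonal rows, the block-spin value of `c·Σ|D_R f|²` is `re μ†X μ` with `X` Hermitian; and **`opNorm_pair_le`** — two effective actions that are
quadratic forms and satisfy the additive bracket `Δ₀ ≤ Δ₁ + e·nsq`, `Δ₁ ≤ Δ₀ + e′·nsq` have `‖X₁ − X₀‖ ≤ max e e′` (row NE2's wall shape at one
level, `VariationalAdditive.opNorm_sub_le_of_form_abs`).  Nothing printed is a hypothesis ([Balaban1985BackgroundPropagators] (3.19)/(3.23) and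
[Balaban1984PropagatorsI] (1.65)/(1.71) are SHAPES); no `def … : Prop` fact; no `sorry`; axioms standard.  HONEST DEPENDENCY (cell, verbatim):
continuum YM on T⁴ ⇐ BetaPertH ∧ nine spine estimates (0/9 proved); BetaPertH ⇐ (D1) ∧ (D4) ∧ CAP+tail; G-an2-4 gates asym, D1 and NE2/3/4.
-/

noncomputable section

open scoped BigOperators ComplexConjugate Matrix Matrix.Norms.L2Operator

namespace Summit.QuantumFields.BalabanUV.T4Continuum.VariationalCovariantScalarForm

open Finset
open Literature.MathematicalPhysics.QuantumFieldTheory.Balaban1983to89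
open Literature.MathematicalPhysics.QuantumFieldTheory.Balaban1983to89.B5Prop11Plancherel (Tor fine unitVec)
open Literature.MathematicalPhysics.QuantumFieldTheory.Balaban1983to89.B5Prop11Lower (nsq nsq_nonneg star_dotProduct_self)
open Literature.MathematicalPhysics.QuantumFieldTheory.Balaban1983to89.B5Block118 (bpt)
open Literature.MathematicalPhysics.QuantumFieldTheory.Balaban1983to89.B5Blocks16 (blockOf blockOf_bpt)
open Literature.MathematicalPhysics.QuantumFieldTheory.Balaban1983to89.B5AverageCurlStokes (sum_translate sum_blocks_real)
open Summit.QuantumFields.BalabanUV.T4Continuum.VariationalTransfer (blockSpin)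
open Summit.QuantumFields.BalabanUV.T4Continuum.VariationalAdditive (opNorm_sub_le_of_form_abs)
open Summit.QuantumFields.BalabanUV.T4Continuum.VariationalOpNorm (opNorm_le_of_quadForm)
open Summit.QuantumFields.BalabanUV.T4Continuum.CoerciveInverseTower (Coercive)
open Summit.QuantumFields.BalabanUV.T4Continuum.VariationalCovariantFederbush (cD dirU Qc dirU_nonneg)
open Summit.QuantumFields.BalabanUV.T4Continuum.VariationalKKT (Sa Kmat effForm blockSpin_eq_quadForm effForm_isHermitian)
open Summit.QuantumFields.BalabanUV.T4Continuum.BalabanAveragedCoerciveFibre (star_dotProduct_conjTranspose_mulVec)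

variable {d : ℕ}

/-! ## §1 The matrices of the covariant difference and of the transported average -/

section Matrices

variable (N : Fin d → ℕ) [∀ μ, NeZero (N μ)]

/-- the matrix of the covariant forward difference: `(Dmat R f)(y,μ) = R(y,μ)f(y+e_μ) − f(y)`. [folklore] -/
def Dmat (R : Tor N → Fin d → ℂ) : Matrix (Tor N × Fin d) (Tor N) ℂ :=
  Matrix.of fun p x => (if x = p.1 + unitVec N p.2 then R p.1 p.2 else 0) - (if x = p.1 then 1 else 0)

/-- `Dmat R *ᵥ f = D_R f`. [folklore] -/
theorem Dmat_mulVec (R : Tor N → Fin d → ℂ) (f : Tor N → ℂ) (p : Tor N × Fin d) :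
    (Dmat N R *ᵥ f) p = cD N R f p.1 p.2 := by
  simp only [Matrix.mulVec, dotProduct, Dmat, Matrix.of_apply, sub_mul, Finset.sum_sub_distrib, ite_mul, zero_mul, one_mul,
    Finset.sum_ite_eq', Finset.mem_univ, if_true, cD]

/-- the matrix of the covariant Dirichlet form in the chosen units: `Smat = c·Dmatᴴ·Dmat`. [folklore] -/
def Smat (R : Tor N → Fin d → ℂ) (c : ℝ) : Matrix (Tor N) (Tor N) ℂ := (c : ℂ) • ((Dmat N R)ᴴ * Dmat N R)

/-- `re f†(Smat) f = c·Σ_μ Σ_y |D_R f(y,μ)|²`. [folklore] -/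
theorem re_form_Smat (R : Tor N → Fin d → ℂ) (c : ℝ) (f : Tor N → ℂ) :
    (star f ⬝ᵥ (Smat N R c *ᵥ f)).re = c * ∑ μ, dirU N R f μ := by
  unfold Smat
  rw [Matrix.smul_mulVec, ← Matrix.mulVec_mulVec, dotProduct_smul, star_dotProduct_conjTranspose_mulVec, star_dotProduct_self,
    smul_eq_mul, Complex.re_ofReal_mul, Complex.ofReal_re]
  congr 1
  unfold nsq dirU
  rw [Fintype.sum_prod_type, Finset.sum_comm]
  exact Finset.sum_congr rfl fun y _ => Finset.sum_congr rfl fun μ _ => by rw [Dmat_mulVec]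

/-- `Smat` is Hermitian. [folklore] -/
theorem Smat_conjTranspose (R : Tor N → Fin d → ℂ) (c : ℝ) : (Smat N R c)ᴴ = Smat N R c := by
  unfold Smat
  rw [Matrix.conjTranspose_smul, Matrix.conjTranspose_mul, Matrix.conjTranspose_conjTranspose, Complex.star_def, Complex.conj_ofReal]

/-- the covariant Dirichlet sum is bounded by `4d·Σ|f|²` for contractive phases. [folklore] -/
theorem sum_dirU_le {R : Tor N → Fin d → ℂ} (hR : ∀ y μ, ‖R y μ‖ ≤ 1) (f : Tor N → ℂ) : ∑ μ, dirU N R f μ ≤ 4 * d * nsq f := by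
  have per : ∀ μ, dirU N R f μ ≤ 4 * nsq f := by
    intro μ
    unfold dirU cD nsq
    have hx : ∀ y, ‖R y μ * f (y + unitVec N μ) - f y‖ ^ 2 ≤ 2 * ‖f (y + unitVec N μ)‖ ^ 2 + 2 * ‖f y‖ ^ 2 := by
      intro y
      have h1 : ‖R y μ * f (y + unitVec N μ) - f y‖ ≤ ‖f (y + unitVec N μ)‖ + ‖f y‖ := by
        refine (norm_sub_le _ _).trans (add_le_add ?_ le_rfl)
        rw [norm_mul]
        calc ‖R y μ‖ * ‖f (y + unitVec N μ)‖ ≤ 1 * ‖f (y + unitVec N μ)‖ := mul_le_mul_of_nonneg_right (hR y μ) (norm_nonneg _)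
          _ = _ := one_mul _
      have h2 := pow_le_pow_left₀ (norm_nonneg _) h1 2
      nlinarith [sq_nonneg (‖f (y + unitVec N μ)‖ - ‖f y‖)]
    refine (sum_le_sum fun y _ => hx y).trans ?_
    rw [sum_add_distrib, ← mul_sum, ← mul_sum]
    have ht : ∑ y, ‖f (y + unitVec N μ)‖ ^ 2 = ∑ y, ‖f y‖ ^ 2 := Equiv.sum_comp (Equiv.addRight (unitVec N μ)) (fun y => ‖f y‖ ^ 2)
    rw [ht]; linarith
  calc ∑ μ, dirU N R f μ ≤ ∑ μ : Fin d, 4 * nsq f := sum_le_sum fun μ _ => per μ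
    _ = 4 * d * nsq f := by rw [sum_const, card_univ, Fintype.card_fin, nsmul_eq_mul]; ring

end Matrices

section Average

variable (Lb : ℕ) [NeZero Lb] (N : Fin d → ℕ) [∀ μ, NeZero (N μ)]

/-- the matrix of the transported block average: `Qmat T z x = L_b^{−d}·T(x)·[x ∈ B(z)]`. [folklore] -/
def Qmat (T : Tor (fine Lb N) → ℂ) : Matrix (Tor N) (Tor (fine Lb N)) ℂ :=
  Matrix.of fun z x => if blockOf Lb N x = z then ((Lb : ℂ) ^ d)⁻¹ * T x else 0

/-- `Qmat T *ᵥ f = Q_T f`. [folklore] -/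
theorem Qmat_mulVec (T f : Tor (fine Lb N) → ℂ) (z : Tor N) : (Qmat Lb N T *ᵥ f) z = Qc Lb N T f z := by
  simp only [Matrix.mulVec, dotProduct, Qmat, Matrix.of_apply, ite_mul, zero_mul]
  have h := Literature.MathematicalPhysics.QuantumFieldTheory.Balaban1983to89.B5Blocks16.sum_blocks Lb N
    (fun x => if blockOf Lb N x = z then ((Lb : ℂ) ^ d)⁻¹ * T x * f x else 0)
  rw [h]
  simp only [blockOf_bpt]
  rw [Finset.sum_comm]
  simp only [Finset.sum_ite_eq', Finset.mem_univ, if_true]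
  rw [Qc, Finset.mul_sum]
  exact Finset.sum_congr rfl fun j _ => by ring

/-- the adjoint: `(Qmatᴴ g)(x) = L_b^{−d}·conj T(x)·g(block of x)`. [folklore] -/
theorem Qmat_conjTranspose_mulVec (T : Tor (fine Lb N) → ℂ) (g : Tor N → ℂ) (x : Tor (fine Lb N)) :
    ((Qmat Lb N T)ᴴ *ᵥ g) x = ((Lb : ℂ) ^ d)⁻¹ * (starRingEnd ℂ) (T x) * g (blockOf Lb N x) := by
  simp only [Matrix.mulVec, dotProduct, Matrix.conjTranspose_apply, Qmat, Matrix.of_apply]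
  rw [Finset.sum_eq_single (blockOf Lb N x) (fun z _ hz => by rw [if_neg (Ne.symm hz), star_zero, zero_mul])
    (fun h => absurd (Finset.mem_univ _) h)]
  rw [if_pos rfl]
  simp only [star_mul', Complex.star_def, map_inv₀, map_pow, Complex.conj_natCast]

/-- **orthogonal rows**: `Qmat·Qmatᴴ = L_b^{−d}·1` for unit-modulus site transports. [folklore] -/
theorem Qmat_mul_conjTranspose (T : Tor (fine Lb N) → ℂ) (hT : ∀ x, ‖T x‖ = 1) :
    Qmat Lb N T * (Qmat Lb N T)ᴴ = ((((Lb : ℝ) ^ d)⁻¹ : ℝ) : ℂ) • (1 : Matrix (Tor N) (Tor N) ℂ) := by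
  have hL : ((Lb : ℂ) ^ d) ≠ 0 := pow_ne_zero _ (by exact_mod_cast NeZero.ne Lb)
  have hcard : (Finset.univ : Finset (Fin d → Fin Lb)).card = Lb ^ d := by
    rw [Finset.card_univ, Fintype.card_fun, Fintype.card_fin, Fintype.card_fin]
  have hTT : ∀ x, T x * (starRingEnd ℂ) (T x) = 1 := fun x => by
    rw [Complex.mul_conj, Complex.normSq_eq_norm_sq, hT, one_pow, Complex.ofReal_one]
  refine Matrix.ext_iff_mulVec.mpr fun g => ?_
  funext z
  rw [← Matrix.mulVec_mulVec, Qmat_mulVec, Qc, Matrix.smul_mulVec, Matrix.one_mulVec, Pi.smul_apply]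
  simp only [Qmat_conjTranspose_mulVec, blockOf_bpt]
  have : ∀ j : Fin d → Fin Lb, T (bpt Lb N z j) * (((Lb : ℂ) ^ d)⁻¹ * (starRingEnd ℂ) (T (bpt Lb N z j)) * g z)
      = ((Lb : ℂ) ^ d)⁻¹ * g z := fun j => by
    calc T (bpt Lb N z j) * (((Lb : ℂ) ^ d)⁻¹ * (starRingEnd ℂ) (T (bpt Lb N z j)) * g z)
        = ((Lb : ℂ) ^ d)⁻¹ * (T (bpt Lb N z j) * (starRingEnd ℂ) (T (bpt Lb N z j))) * g z := by ring
      _ = _ := by rw [hTT, mul_one]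
  simp_rw [this]
  rw [sum_const, hcard, nsmul_eq_mul, Nat.cast_pow, smul_eq_mul]
  push_cast
  field_simp

/-- `Σ_z |Q_T f z|² ≤ L_b^{−d}·Σ|f|²` for contractive transports (block Cauchy–Schwarz). [folklore] -/
theorem nsq_Qmat_mulVec_le (T : Tor (fine Lb N) → ℂ) (hT : ∀ x, ‖T x‖ ≤ 1) (f : Tor (fine Lb N) → ℂ) :
    nsq (Qmat Lb N T *ᵥ f) ≤ ((Lb : ℝ) ^ d)⁻¹ * nsq f := by
  have hL : (0 : ℝ) < (Lb : ℝ) ^ d := by have := NeZero.ne Lb; positivity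
  have hcard : ((Finset.univ : Finset (Fin d → Fin Lb)).card : ℝ) = (Lb : ℝ) ^ d := by
    rw [Finset.card_univ, Fintype.card_fun, Fintype.card_fin, Fintype.card_fin]; push_cast; ring
  unfold nsq
  rw [sum_blocks_real Lb N (fun x => ‖f x‖ ^ 2), mul_sum]
  refine sum_le_sum fun z _ => ?_
  rw [Qmat_mulVec, Qc, norm_mul, norm_inv, norm_pow, Complex.norm_natCast, mul_pow]
  have h1 : ‖∑ j : Fin d → Fin Lb, T (bpt Lb N z j) * f (bpt Lb N z j)‖ ^ 2 ≤ (Lb : ℝ) ^ d * ∑ j : Fin d → Fin Lb, ‖f (bpt Lb N z j)‖ ^ 2 := by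
    have h2 : ‖∑ j : Fin d → Fin Lb, T (bpt Lb N z j) * f (bpt Lb N z j)‖ ≤ ∑ j : Fin d → Fin Lb, ‖f (bpt Lb N z j)‖ := by
      refine (norm_sum_le _ _).trans (sum_le_sum fun j _ => ?_)
      rw [norm_mul]
      calc ‖T (bpt Lb N z j)‖ * ‖f (bpt Lb N z j)‖ ≤ 1 * ‖f (bpt Lb N z j)‖ := mul_le_mul_of_nonneg_right (hT _) (norm_nonneg _)
        _ = _ := one_mul _
    calc _ ≤ (∑ j : Fin d → Fin Lb, ‖f (bpt Lb N z j)‖) ^ 2 := pow_le_pow_left₀ (norm_nonneg _) h2 2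
      _ ≤ (Finset.univ : Finset (Fin d → Fin Lb)).card * ∑ j : Fin d → Fin Lb, ‖f (bpt Lb N z j)‖ ^ 2 := sq_sum_le_card_mul_sum_sq
      _ = _ := by rw [hcard]
  calc (((Lb : ℝ) ^ d)⁻¹) ^ 2 * ‖∑ j : Fin d → Fin Lb, T (bpt Lb N z j) * f (bpt Lb N z j)‖ ^ 2
      ≤ (((Lb : ℝ) ^ d)⁻¹) ^ 2 * ((Lb : ℝ) ^ d * ∑ j : Fin d → Fin Lb, ‖f (bpt Lb N z j)‖ ^ 2) :=
        mul_le_mul_of_nonneg_left h1 (by positivity)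
    _ = ((Lb : ℝ) ^ d)⁻¹ * ∑ j : Fin d → Fin Lb, ‖f (bpt Lb N z j)‖ ^ 2 := by field_simp

end Average

/-! ## §2 The block-spin value of the covariant Dirichlet form is a Hermitian quadratic form -/

section Form

variable {N : Fin d → ℕ} [∀ μ, NeZero (N μ)] {κ : Type*} [Fintype κ] [DecidableEq κ]

/-- **LEAF D FOR THE CHARGED SCALAR (one level, any constraint with orthogonal rows)**: for contractive phases `R`, units `c > 0`, a soft
weight `a > 0`, a constraint matrix `Qm` with `Qm·Qmᴴ = c_Q·1` (`c_Q > 0`) and `Σ|Qm f|² ≤ C_Q·Σ|f|²`, and a P⁺-shaped coercivity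
`Σ|f|² ≤ A·Σ|Qm f|² + B·(c·Σ|D_R f|²)`: the block-spin value is a HERMITIAN QUADRATIC FORM,
`blockSpin (Qm·) (f ↦ c·Σ|D_R f|²) μ = re μ†X μ`, `X = VariationalKKT.effForm (Smat R c) Qm a`. [folklore] -/
theorem blockSpin_dirichlet_eq_form {R : Tor N → Fin d → ℂ} (hR : ∀ y μ, ‖R y μ‖ ≤ 1) {c a cQ CQ A B : ℝ}
    (hc : 0 < c) (ha : 0 < a) (hcQ : 0 < cQ) (hCQ : 0 ≤ CQ) (hA : 0 ≤ A) (hB : 0 ≤ B)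
    {Qm : Matrix κ (Tor N) ℂ} (hQQ : Qm * Qmᴴ = (cQ : ℂ) • 1) (hQn : ∀ f, nsq (Qm *ᵥ f) ≤ CQ * nsq f)
    (hP : ∀ f, nsq f ≤ A * nsq (Qm *ᵥ f) + B * (c * ∑ μ, dirU N R f μ)) :
    (effForm (Smat N R c) Qm a).IsHermitian ∧
      ∀ μ : κ → ℂ, blockSpin (fun f => Qm *ᵥ f) (fun f => c * ∑ ν, dirU N R f ν) μ
        = (star μ ⬝ᵥ (effForm (Smat N R c) Qm a *ᵥ μ)).re := by
  have hSH : (Smat N R c)ᴴ = Smat N R c := Smat_conjTranspose N R c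
  have hS0 : ∀ f, 0 ≤ (star f ⬝ᵥ (Smat N R c *ᵥ f)).re := fun f => by
    rw [re_form_Smat]; exact mul_nonneg hc.le (sum_nonneg fun μ _ => dirU_nonneg _ _ _ _)
  -- the form of S_a on any f
  have hSa : ∀ f, (star f ⬝ᵥ (Sa (Smat N R c) Qm a *ᵥ f)).re = c * ∑ μ, dirU N R f μ + a * nsq (Qm *ᵥ f) := by
    intro f
    unfold Sa
    rw [Matrix.add_mulVec, Matrix.smul_mulVec, ← Matrix.mulVec_mulVec, dotProduct_add, dotProduct_smul,
      star_dotProduct_conjTranspose_mulVec, star_dotProduct_self, Complex.add_re, smul_eq_mul, Complex.re_ofReal_mul, Complex.ofReal_re,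
      re_form_Smat]
  -- coercivity of S_a from the P⁺-shaped hypothesis
  set γ : ℝ := (A / a + B + 1)⁻¹ with hγ
  have hγ0 : 0 < γ := by rw [hγ]; positivity
  have hcoer : Coercive γ (Sa (Smat N R c) Qm a) := by
    intro f
    rw [hSa]
    have hD0 : 0 ≤ c * ∑ μ, dirU N R f μ := mul_nonneg hc.le (sum_nonneg fun μ _ => dirU_nonneg _ _ _ _)
    have hQ0 : 0 ≤ nsq (Qm *ᵥ f) := nsq_nonneg _
    have h1 : nsq f ≤ (A / a + B + 1) * (c * ∑ μ, dirU N R f μ + a * nsq (Qm *ᵥ f)) := by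
      have e : A * nsq (Qm *ᵥ f) = A / a * (a * nsq (Qm *ᵥ f)) := by field_simp
      nlinarith [hP f, mul_nonneg hB (mul_nonneg ha.le hQ0), mul_nonneg (div_nonneg hA ha.le) hD0, hD0, hQ0]
    have hpos : 0 < A / a + B + 1 := by positivity
    rw [hγ]
    calc (A / a + B + 1)⁻¹ * nsq f ≤ (A / a + B + 1)⁻¹ * ((A / a + B + 1) * (c * ∑ μ, dirU N R f μ + a * nsq (Qm *ᵥ f))) :=
          mul_le_mul_of_nonneg_left h1 (by positivity)
      _ = _ := by field_simp
  -- op-norm bound of S_a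
  set Λ : ℝ := c * (4 * d) + a * CQ + 1 with hΛ
  have hΛ0 : 0 < Λ := by rw [hΛ]; positivity
  have hSaH : (Sa (Smat N R c) Qm a).IsHermitian := VariationalKKT.Sa_conjTranspose hSH
  have hnorm : ‖Sa (Smat N R c) Qm a‖ ≤ Λ := by
    refine opNorm_le_of_quadForm hSaH hΛ0.le fun f => ?_
    rw [hSa]
    have hD0 : 0 ≤ c * ∑ μ, dirU N R f μ := mul_nonneg hc.le (sum_nonneg fun μ _ => dirU_nonneg _ _ _ _)
    have hQ0 : 0 ≤ nsq (Qm *ᵥ f) := nsq_nonneg _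
    rw [abs_of_nonneg (by positivity)]
    have h1 := mul_le_mul_of_nonneg_left (sum_dirU_le N hR f) hc.le
    have h2 := mul_le_mul_of_nonneg_left (hQn f) ha.le
    have hf0 : 0 ≤ nsq f := nsq_nonneg f
    have : nsq f = ∑ i, ‖f i‖ ^ 2 := rfl
    rw [← this, hΛ]
    nlinarith
  refine ⟨effForm_isHermitian hSH, fun μ => ?_⟩
  have h := (blockSpin_eq_quadForm (a := a) hSH hS0 hcQ hγ0 hΛ0 hQQ hcoer hnorm μ).2.2
  -- the two block-spin values coincide (same constraint map, same action)
  have e : blockSpin (fun f => Qm *ᵥ f) (fun f => c * ∑ ν, dirU N R f ν) μ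
      = blockSpin (fun f => Qm *ᵥ f) (fun f => (star f ⬝ᵥ (Smat N R c *ᵥ f)).re) μ := by
    congr 1; funext f; rw [re_form_Smat]
  rw [e, h]

/-- **THE PAIR IN THE CONSUMER'S CURRENCY** (one level): if two effective actions are quadratic forms of Hermitian `X₀`, `X₁` and satisfy the
additive bracket `Δ₀(μ) ≤ Δ₁(μ) + e·Σ|μ|²`, `Δ₁(μ) ≤ Δ₀(μ) + e′·Σ|μ|²`, then `‖X₁ − X₀‖ ≤ max e e′`. [folklore] -/
theorem opNorm_pair_le {X₀ X₁ : Matrix κ κ ℂ} (h₀ : X₀.IsHermitian) (h₁ : X₁.IsHermitian) {Δ₀ Δ₁ : (κ → ℂ) → ℝ}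
    (hX₀ : ∀ μ, Δ₀ μ = (star μ ⬝ᵥ (X₀ *ᵥ μ)).re) (hX₁ : ∀ μ, Δ₁ μ = (star μ ⬝ᵥ (X₁ *ᵥ μ)).re) {e e' : ℝ} (he : 0 ≤ e)
    (hlow : ∀ μ, Δ₀ μ ≤ Δ₁ μ + e * nsq μ) (hup : ∀ μ, Δ₁ μ ≤ Δ₀ μ + e' * nsq μ) :
    ‖X₁ - X₀‖ ≤ max e e' := by
  have hm : 0 ≤ max e e' := le_max_of_le_left he
  refine opNorm_sub_le_of_form_abs h₀ h₁ hm (fun μ => ?_) (fun μ => ?_)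
  · have h := hup μ
    rw [hX₀, hX₁] at h
    have : e' * nsq μ ≤ max e e' * ∑ i, ‖μ i‖ ^ 2 := mul_le_mul_of_nonneg_right (le_max_right _ _) (nsq_nonneg μ)
    linarith
  · have h := hlow μ
    rw [hX₀, hX₁] at h
    have : e * nsq μ ≤ max e e' * ∑ i, ‖μ i‖ ^ 2 := mul_le_mul_of_nonneg_right (le_max_left _ _) (nsq_nonneg μ)
    linarith

end Form

end Summit.QuantumFields.BalabanUV.T4Continuum.VariationalCovariantScalarForm

end
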